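import Summits.AtomisticToContinuum.BoseEinsteinCondensation.Theorems.BECHeatBathGapJastrowDobrushinRungModel

/-!
# Route `BECHeatBathGap` — support item `JastrowDobrushinRung` (stmt-AtomisticToContinuum-14373):
# the Jastrow model on `Λ_L^N`, part 2: Dobrushin's condition and the real-valued theorem (helper file 7)

Helpers for the proof of
`Summit.AtomisticToContinuum.BoseEinsteinCondensation.Theses.BECHeatBathGap.JastrowDobrushinRung`
(approximate tensorisation of variance with constant 2 for the Jastrow law under
`5N∫(1-f²) ≤ L³`, via Dobrushin uniqueness ⇒ heat-bath spectral gap ≥ 1 - r, Wu 2006, re-proved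
from scratch). As in helper file 1, the operators `S` (one-site average), `T` (heat bath),
`P = N⁻¹∑T_j` (random-scan Gibbs sampler) and the weights `w = B_j π_j` are variables with
defining hypotheses `hS, hT, hP, hw, …` (no auxiliary definitions).

This file: the one-site partition function bound `Z_j ≥ 1 - (N-1)β` (`model_Z`), the `L¹`
influence bound `∫|p - p'| ≤ 2β` (`model_L1`), Dobrushin's condition with
`c = 2β/(1-(N-1)β)` (`model_hD`), the real-valued approximate tensorisation with constant `2`
under `5N∫(1-f²) ≤ L³` (`model_AT`, row sum `r ≤ 1/2`), and two conversion lemmas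
(`volume_restrict_boxN_eq_smul_pi`, `lintegral_nnnorm_sq_mul_eq`).
-/

noncomputable section

namespace Summit.AtomisticToContinuum.BoseEinsteinCondensation.Theorems

namespace JastrowDobrushin

open MeasureTheory Function
open scoped ENNReal

section Model

open Literature.MathematicalPhysics.QuantumManyBody.BoseGas

variable {N : ℕ} {L : ℝ} {f : Space → ℝ}
variable {πN BN : Fin N → (Fin N → Space) → ℝ} {wN : (Fin N → Space) → ℝ}

variable {uL : Measure Space}
  {S' T' : Fin N → ((Fin N → Space) → ℝ) → (Fin N → Space) → ℝ}

/-- **One-site partition function bound**: `Z_j(X) = ∫ π_j(X[j ↦ z]) du(z) ≥ 1 - (N-1)β`,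
uniformly in the configuration `X` (from `∏(1-ε_k) ≥ 1 - ∑ ε_k` and translation invariance).
[folklore] -/
theorem model_Z (hL : 0 < L) (hf : Measurable f) (hf01 : ∀ x, 0 ≤ f x ∧ f x ≤ 1)
    (hI : Integrable (fun x => 1 - f x ^ 2))
    (huL : uL = (ENNReal.ofReal (L ^ 3))⁻¹ • volume.restrict (box L))
    (hS' : ∀ j G X, S' j G X = ∫ y, G (update X j y) ∂uL)
    (hπN : ∀ j X, πN j X = ∏ k ∈ Finset.univ.erase j,
      (if k < j then f (X k - X j) ^ 2 else f (X j - X k) ^ 2))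
    (j : Fin N) (X : Fin N → Space) :
    1 - ((N : ℝ) - 1) * ((∫ y, (1 - f y ^ 2)) / L ^ 3) ≤ S' j (πN j) X := by
  haveI : IsProbabilityMeasure uL := huL ▸ isProbabilityMeasure_boxMeasure hL
  set β : ℝ := (∫ y, (1 - f y ^ 2)) / L ^ 3 with hβ
  set g : Fin N → Space → ℝ := fun k z => if k < j then f (X k - z) ^ 2 else f (z - X k) ^ 2
    with hg
  have hsq : ∀ x, 0 ≤ f x ^ 2 ∧ f x ^ 2 ≤ 1 := fun x =>
    ⟨sq_nonneg _, pow_le_one₀ (hf01 x).1 (hf01 x).2⟩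
  have hg01 : ∀ k z, 0 ≤ g k z ∧ g k z ≤ 1 := fun k z => by
    simp only [hg]; split_ifs <;> exact hsq _
  have hgm : ∀ k, Measurable (g k) := fun k => by
    by_cases h : k < j
    · simp only [hg, h, ↓reduceIte]; fun_prop
    · simp only [hg, h, ↓reduceIte]; fun_prop
  have hgi : ∀ k, Integrable (fun z => 1 - g k z) uL := fun k =>
    integrable_of_bounded (measurable_const.sub (hgm k)) (C := 1) fun z => by
      rw [abs_of_nonneg (by linarith [(hg01 k z).2])]; linarith [(hg01 k z).1]
  have hdef : ∀ k, ∫ z, (1 - g k z) ∂uL ≤ β := fun k => by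
    by_cases h : k < j
    · simp only [hg, h, ↓reduceIte]; rw [huL]; exact (deficit_le hL hf01 hI (X k)).1
    · simp only [hg, h, ↓reduceIte]; rw [huL]; exact (deficit_le hL hf01 hI (X k)).2
  have hN : 1 ≤ N := Fin.pos j
  have hcard : ((Finset.univ.erase j).card : ℝ) = (N : ℝ) - 1 := by
    rw [Finset.card_erase_of_mem (Finset.mem_univ j), Finset.card_univ, Fintype.card_fin,
      Nat.cast_sub hN, Nat.cast_one]
  rw [hS']
  simp_rw [pi_update_eq hπN j X]
  have hprodm : Measurable fun z => ∏ k ∈ Finset.univ.erase j, g k z :=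
    Finset.measurable_prod _ fun k _ => hgm k
  have hprodi : Integrable (fun z => ∏ k ∈ Finset.univ.erase j, g k z) uL :=
    integrable_of_bounded hprodm (C := 1) fun z => by
      rw [abs_of_nonneg (Finset.prod_nonneg fun k _ => (hg01 k z).1)]
      exact Finset.prod_le_one (fun k _ => (hg01 k z).1) fun k _ => (hg01 k z).2
  have hsumi : Integrable (fun z => ∑ k ∈ Finset.univ.erase j, (1 - g k z)) uL :=
    integrable_finsetSum _ fun k _ => hgi k
  calc 1 - ((N : ℝ) - 1) * β = 1 - ∑ _k ∈ Finset.univ.erase j, β := by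
        rw [Finset.sum_const, nsmul_eq_mul, hcard]
    _ ≤ 1 - ∑ k ∈ Finset.univ.erase j, ∫ z, (1 - g k z) ∂uL := by
        gcongr with k _
        exact hdef k
    _ = ∫ z, (1 - ∑ k ∈ Finset.univ.erase j, (1 - g k z)) ∂uL := by
        rw [integral_sub (integrable_const _) hsumi, integral_const, probReal_univ, one_smul,
          integral_finsetSum _ fun k _ => hgi k]
    _ ≤ ∫ z, ∏ k ∈ Finset.univ.erase j, g k z ∂uL :=
        integral_mono ((integrable_const _).sub hsumi) hprodi fun z => by
          have := one_sub_prod_le_sum (Finset.univ.erase j) (fun k => g k z)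
            fun k _ => hg01 k z
          simp only
          linarith


/-- **`L¹` influence bound**: moving the particle `k ≠ j` changes the (unnormalised) one-site
density of `x_j` by at most `2β` in `L¹(du)`. [folklore] -/
theorem model_L1 (hL : 0 < L) (hf : Measurable f) (hf01 : ∀ x, 0 ≤ f x ∧ f x ≤ 1)
    (hI : Integrable (fun x => 1 - f x ^ 2))
    (huL : uL = (ENNReal.ofReal (L ^ 3))⁻¹ • volume.restrict (box L))
    (hπN : ∀ j X, πN j X = ∏ k ∈ Finset.univ.erase j,
      (if k < j then f (X k - X j) ^ 2 else f (X j - X k) ^ 2))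
    {j k : Fin N} (hjk : j ≠ k) (X : Fin N → Space) (y y' : Space) :
    ∫ z, |πN j (update (update X k y) j z) - πN j (update (update X k y') j z)| ∂uL ≤
      2 * ((∫ y, (1 - f y ^ 2)) / L ^ 3) := by
  haveI : IsProbabilityMeasure uL := huL ▸ isProbabilityMeasure_boxMeasure hL
  have hsq : ∀ x, 0 ≤ f x ^ 2 ∧ f x ^ 2 ≤ 1 := fun x =>
    ⟨sq_nonneg _, pow_le_one₀ (hf01 x).1 (hf01 x).2⟩
  have hkmem : k ∈ Finset.univ.erase j := Finset.mem_erase.mpr ⟨hjk.symm, Finset.mem_univ k⟩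
  set R : Space → ℝ := fun z => ∏ i ∈ (Finset.univ.erase j).erase k,
    (if i < j then f (X i - z) ^ 2 else f (z - X i) ^ 2) with hR
  set a : Space → Space → ℝ := fun y z => if k < j then f (y - z) ^ 2 else f (z - y) ^ 2 with ha
  have hR01 : ∀ z, 0 ≤ R z ∧ R z ≤ 1 := fun z => by
    refine ⟨Finset.prod_nonneg fun i _ => ?_, Finset.prod_le_one (fun i _ => ?_) fun i _ => ?_⟩ <;>
      split_ifs <;> simp [hsq]
  have ha01 : ∀ y z, 0 ≤ a y z ∧ a y z ≤ 1 := fun y z => by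
    simp only [ha]; split_ifs <;> exact hsq _
  have ham : ∀ y, Measurable (a y) := fun y => by
    by_cases h : k < j
    · simp only [ha, h, ↓reduceIte]; fun_prop
    · simp only [ha, h, ↓reduceIte]; fun_prop
  have hp : ∀ y z, πN j (update (update X k y) j z) = a y z * R z := by
    intro y z
    rw [pi_update_eq hπN, ← Finset.mul_prod_erase _ _ hkmem]
    congr 1
    · simp only [ha, update_self]
    · refine Finset.prod_congr rfl fun i hi => ?_
      rw [update_of_ne (Finset.ne_of_mem_erase hi)]
  have hdef : ∀ y, ∫ z, (1 - a y z) ∂uL ≤ (∫ y, (1 - f y ^ 2)) / L ^ 3 := fun y => by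
    by_cases h : k < j
    · simp only [ha, h, ↓reduceIte]; rw [huL]; exact (deficit_le hL hf01 hI y).1
    · simp only [ha, h, ↓reduceIte]; rw [huL]; exact (deficit_le hL hf01 hI y).2
  have hai : ∀ y, Integrable (fun z => 1 - a y z) uL := fun y =>
    integrable_of_bounded (measurable_const.sub (ham y)) (C := 1) fun z => by
      rw [abs_of_nonneg (by linarith [(ha01 y z).2])]; linarith [(ha01 y z).1]
  have hpt : ∀ z, |πN j (update (update X k y) j z) - πN j (update (update X k y') j z)| ≤
      (1 - a y z) + (1 - a y' z) := fun z => by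
    rw [hp, hp, ← sub_mul, abs_mul, abs_of_nonneg (hR01 z).1]
    refine (mul_le_of_le_one_right (abs_nonneg _) (hR01 z).2).trans ?_
    rw [abs_le]
    constructor <;> linarith [(ha01 y z).1, (ha01 y z).2, (ha01 y' z).1, (ha01 y' z).2]
  have hlm : Measurable fun z => |πN j (update (update X k y) j z) -
      πN j (update (update X k y') j z)| := by
    have hπm := (model_hπ hf hf01 hπN j).1
    exact ((hπm.comp (measurable_update _)).sub (hπm.comp (measurable_update _))).abs
  have hli : Integrable (fun z => |πN j (update (update X k y) j z) -
      πN j (update (update X k y') j z)|) uL :=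
    integrable_of_bounded hlm (C := 2) fun z => by
      rw [abs_abs]
      exact (hpt z).trans (by linarith [(ha01 y z).1, (ha01 y' z).1])
  have hsi : Integrable (fun z => (1 - a y z) + (1 - a y' z)) uL := (hai y).add (hai y')
  calc ∫ z, |πN j (update (update X k y) j z) - πN j (update (update X k y') j z)| ∂uL
      ≤ ∫ z, ((1 - a y z) + (1 - a y' z)) ∂uL := integral_mono hli hsi hpt
    _ = ∫ z, (1 - a y z) ∂uL + ∫ z, (1 - a y' z) ∂uL := integral_add (hai y) (hai y')
    _ ≤ _ := by linarith [hdef y, hdef y']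

/-- **Dobrushin's condition for the Jastrow law**: the one-site conditional law of `x_j`
moves by at most `c δ`, `c = 2β / (1 - (N-1)β)`, on test functions of oscillation `δ`, when
any other particle is moved (uniformly in the boundary condition). [folklore] -/
theorem model_hD (hL : 0 < L) (hf : Measurable f) (hf01 : ∀ x, 0 ≤ f x ∧ f x ≤ 1)
    (hI : Integrable (fun x => 1 - f x ^ 2))
    (huL : uL = (ENNReal.ofReal (L ^ 3))⁻¹ • volume.restrict (box L))
    (hS' : ∀ j G X, S' j G X = ∫ y, G (update X j y) ∂uL)
    (hT' : ∀ j F X, T' j F X = S' j (fun Y => F Y * πN j Y) X / S' j (πN j) X)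
    (hπN : ∀ j X, πN j X = ∏ k ∈ Finset.univ.erase j,
      (if k < j then f (X k - X j) ^ 2 else f (X j - X k) ^ 2))
    (hζ : ((N : ℝ) - 1) * ((∫ y, (1 - f y ^ 2)) / L ^ 3) < 1) :
    ∀ j k, j ≠ k → ∀ (X : Fin N → Space) (y y' : Space) (φ : Space → ℝ) (Cφ δ : ℝ),
      Measurable φ → (∀ z, |φ z| ≤ Cφ) → (∀ z z', |φ z - φ z'| ≤ δ) →
      |T' j (fun Y => φ (Y j)) (update X k y) - T' j (fun Y => φ (Y j)) (update X k y')| ≤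
        (2 * ((∫ y, (1 - f y ^ 2)) / L ^ 3) / (1 - ((N : ℝ) - 1) * ((∫ y, (1 - f y ^ 2)) / L ^ 3)))
          * δ := by
  intro j k hjk X y y' φ Cφ δ hφm hφb hφδ
  haveI : IsProbabilityMeasure uL := huL ▸ isProbabilityMeasure_boxMeasure hL
  set β : ℝ := (∫ y, (1 - f y ^ 2)) / L ^ 3 with hβ
  have hπ := model_hπ hf hf01 hπN j
  have key : ∀ y, T' j (fun Y => φ (Y j)) (update X k y) =
      (∫ z, φ z * πN j (update (update X k y) j z) ∂uL) /
        (∫ z, πN j (update (update X k y) j z) ∂uL) := by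
    intro y
    rw [hT', hS', hS']
    simp only [update_self]
  rw [key, key]
  have hZ : ∀ y, 1 - ((N : ℝ) - 1) * β ≤ ∫ z, πN j (update (update X k y) j z) ∂uL := fun y => by
    rw [← hS']; exact model_Z hL hf hf01 hI huL hS' hπN j _
  have h := abs_div_sub_div_le (u := uL) (p := fun z => πN j (update (update X k y) j z))
    (p' := fun z => πN j (update (update X k y') j z)) (hπ.1.comp (measurable_update _))
    (hπ.1.comp (measurable_update _)) (fun z => hπ.2 _) (fun z => hπ.2 _) (by linarith) (hZ y)
    (hZ y') (model_L1 hL hf hf01 hI huL hπN hjk X y y') hφm hφb hφδ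
  calc _ ≤ δ * (2 * β) / (1 - ((N : ℝ) - 1) * β) := h
    _ = 2 * β / (1 - ((N : ℝ) - 1) * β) * δ := by ring


/-- **Approximate tensorisation for the Jastrow law (real-valued form).** Under
`5N∫(1-f²) ≤ L³` the Dobrushin row sum is `r ≤ 1/2`, so the abstract theorem gives
`∫ (F - c₀)² w ≤ 2 ∑_j ∫ (F - g_j)² w` on `Λ_L^N` with the normalised product measure.
[folklore] -/
theorem model_AT (hL : 0 < L) (hf : Measurable f) (hf01 : ∀ x, 0 ≤ f x ∧ f x ≤ 1)
    (hI : Integrable (fun x => 1 - f x ^ 2))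
    (h5 : 5 * (N : ℝ) * (∫ x, (1 - f x ^ 2)) ≤ L ^ 3) (hN : 0 < N)
    (huL : uL = (ENNReal.ofReal (L ^ 3))⁻¹ • volume.restrict (box L))
    (hS' : ∀ j G X, S' j G X = ∫ y, G (update X j y) ∂uL)
    (hT' : ∀ j F X, T' j F X = S' j (fun Y => F Y * πN j Y) X / S' j (πN j) X)
    (hπN : ∀ j X, πN j X = ∏ k ∈ Finset.univ.erase j,
      (if k < j then f (X k - X j) ^ 2 else f (X j - X k) ^ 2))
    (hBN : ∀ j X, BN j X = ∏ i, ∏ l ∈ Finset.univ.filter (fun l => i < l),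
      (if i = j ∨ l = j then 1 else f (X i - X l) ^ 2))
    (hwN : ∀ X, wN X = ∏ i, ∏ l ∈ Finset.univ.filter (fun l => i < l), f (X i - X l) ^ 2)
    {P' : ((Fin N → Space) → ℝ) → (Fin N → Space) → ℝ}
    (hP' : ∀ F X, P' F X = (Fintype.card (Fin N) : ℝ)⁻¹ * ∑ j, T' j F X)
    {F : (Fin N → Space) → ℝ} (hFm : Measurable F) {C : ℝ} (hFb : ∀ X, |F X| ≤ C)
    {g : Fin N → (Fin N → Space) → ℝ} (hgm : ∀ j, Measurable (g j)) {C' : ℝ}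
    (hgb : ∀ j X, |g j X| ≤ C') (hg : ∀ j X y, g j (update X j y) = g j X) :
    ∫ X, (F X - (∫ Y, F Y * wN Y ∂(Measure.pi fun _ => uL)) /
        (∫ Y, wN Y ∂(Measure.pi fun _ => uL))) ^ 2 * wN X ∂(Measure.pi fun _ => uL) ≤
      2 * ∑ j, ∫ X, (F X - g j X) ^ 2 * wN X ∂(Measure.pi fun _ => uL) := by
  haveI : IsProbabilityMeasure uL := huL ▸ isProbabilityMeasure_boxMeasure hL
  haveI : Nonempty (Fin N) := ⟨⟨0, hN⟩⟩
  set I : ℝ := ∫ x, (1 - f x ^ 2) with hIdef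
  set β : ℝ := I / L ^ 3 with hβ
  have hI0 : 0 ≤ I := integral_nonneg fun x => by
    simp only [Pi.zero_apply]
    have := hf01 x
    nlinarith
  have hL3 : 0 < L ^ 3 := by positivity
  have hβ0 : 0 ≤ β := div_nonneg hI0 hL3.le
  have hNβ : (N : ℝ) * β ≤ 1 / 5 := by
    rw [hβ, mul_div_assoc', div_le_iff₀ hL3]; linarith
  have hN1 : (1 : ℝ) ≤ N := by exact_mod_cast hN
  have ht0 : 0 ≤ ((N : ℝ) - 1) * β := mul_nonneg (by linarith) hβ0
  have ht : ((N : ℝ) - 1) * β ≤ 1 / 5 := by nlinarith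
  have hζ : ((N : ℝ) - 1) * β < 1 := by linarith
  have hc0 : 0 ≤ 2 * β / (1 - ((N : ℝ) - 1) * β) := div_nonneg (by linarith) (by linarith)
  have hcard : (Fintype.card (Fin N) : ℝ) = N := by rw [Fintype.card_fin]
  have hr : ((Fintype.card (Fin N) : ℝ) - 1) * (2 * β / (1 - ((N : ℝ) - 1) * β)) ≤ 1 / 2 := by
    rw [hcard, mul_div_assoc', div_le_iff₀ (by linarith)]
    nlinarith
  have hw1 : ∀ X, 0 ≤ wN X := fun X => by
    rw [hwN]
    exact Finset.prod_nonneg fun i _ => Finset.prod_nonneg fun l _ => sq_nonneg _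
  have key := integral_sub_mean_sq_mul_w_le (u := uL) (S := S') (T := T') (π := πN) (w := wN)
    (B := BN) (P := P') hS' hT' (model_hπ hf hf01 hπN)
    (fun j X => lt_of_lt_of_le (by linarith) (model_Z hL hf hf01 hI huL hS' hπN j X))
    (w_eq_B_mul_pi hπN hBN hwN) (model_hB hf hf01 hBN) hP' hc0
    (model_hD hL hf hf01 hI huL hS' hT' hπN hζ) (by linarith) hFm hFb hgm hgb hg
  refine key.trans (mul_le_mul_of_nonneg_right ?_ (Finset.sum_nonneg fun j _ =>
    integral_nonneg fun X => mul_nonneg (sq_nonneg _) (hw1 X)))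
  rw [inv_le_comm₀ (by linarith) (by norm_num)]
  linarith


/-- Lebesgue measure on `Λ_L^N` is `L^{3N}` times the product of the normalised box measures.
[folklore] -/
theorem volume_restrict_boxN_eq_smul_pi (hL : 0 < L) (N : ℕ) :
    (volume : Measure (Fin N → Space)).restrict (boxN N L) =
      (ENNReal.ofReal (L ^ 3)) ^ N •
        Measure.pi (fun _ : Fin N => (ENNReal.ofReal (L ^ 3))⁻¹ • volume.restrict (box L)) := by
  haveI : IsProbabilityMeasure ((ENNReal.ofReal (L ^ 3))⁻¹ • (volume.restrict (box L) :
    Measure Space)) := isProbabilityMeasure_boxMeasure hL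
  have hK0 : ENNReal.ofReal (L ^ 3) ≠ 0 := (ENNReal.ofReal_pos.mpr (by positivity)).ne'
  have hKt : ENNReal.ofReal (L ^ 3) ≠ ⊤ := ENNReal.ofReal_ne_top
  have hbox : boxN N L = Set.pi Set.univ fun _ : Fin N => box L := by ext X; simp [boxN]
  have h1 : (volume : Measure (Fin N → Space)).restrict (boxN N L) =
      Measure.pi fun _ : Fin N => (volume : Measure Space).restrict (box L) := by
    rw [hbox]
    exact Measure.restrict_pi_pi (μ := fun _ : Fin N => (volume : Measure Space)) fun _ => box L
  rw [h1]
  refine Measure.pi_eq fun s _ => ?_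
  rw [Measure.smul_apply, Measure.pi_pi, smul_eq_mul]
  simp_rw [Measure.smul_apply, smul_eq_mul]
  rw [Finset.prod_mul_distrib, Finset.prod_const, Finset.card_univ, Fintype.card_fin, ← mul_assoc,
    ← mul_pow, ENNReal.mul_inv_cancel hK0 hKt, one_pow, one_mul]

/-- The weighted `L²`-deficit as a lower Lebesgue integral equals `ofReal` of the Bochner
integral (bounded measurable data, finite measure). [folklore] -/
theorem lintegral_nnnorm_sq_mul_eq {μ : Measure (Fin N → Space)} [IsFiniteMeasure μ]
    {G : (Fin N → Space) → ℂ} (hGm : Measurable G) {M : ℝ} (hGb : ∀ X, ‖G X‖ ≤ M)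
    {v : (Fin N → Space) → ℝ} (hvm : Measurable v) (hv : ∀ X, 0 ≤ v X ∧ v X ≤ 1) :
    ∫⁻ X, (‖G X‖₊ : ℝ≥0∞) ^ 2 * ENNReal.ofReal (v X) ∂μ =
      ENNReal.ofReal (∫ X, ‖G X‖ ^ 2 * v X ∂μ) := by
  have h1 : ∀ X, (‖G X‖₊ : ℝ≥0∞) ^ 2 * ENNReal.ofReal (v X) =
      ENNReal.ofReal (‖G X‖ ^ 2 * v X) := fun X => by
    rw [← enorm_eq_nnnorm, ← ofReal_norm, ← ENNReal.ofReal_pow (norm_nonneg _),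
      ← ENNReal.ofReal_mul (sq_nonneg _)]
  simp_rw [h1]
  rw [← ofReal_integral_eq_lintegral_ofReal]
  · exact integrable_mul_w (hGm.norm.pow_const 2) (C := M ^ 2) (fun X => by
      rw [abs_pow, abs_norm]; exact pow_le_pow_left₀ (norm_nonneg _) (hGb X) 2) hvm hv
  · exact ae_of_all _ fun X => mul_nonneg (sq_nonneg _) (hv X).1

end Model

end JastrowDobrushin

end Summit.AtomisticToContinuum.BoseEinsteinCondensation.Theorems
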